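import Literature.NumberTheory.Irrationality.RhinViola2001.TheoremFiveOne
import HarnessLib

/-!
# Rhin–Viola 2001, (5.15)–(5.16): `lim (1/n) log I_n = max log f` — the growth of the integrals `I_n`

Topic `Literature/NumberTheory/Irrationality/RhinViola2001`. Typed-and-PROVED (no named fact; cell `zeta5-irr`, seat
zi-lit g17) from G. Rhin, C. Viola, *The group structure for ζ(3)*, Acta Arith. **97** (2001) 269–293 [RhinViola2001],
§5 p. 291 (held text `paper:doi-10-4064-aa97-3-6`, p0023 read on the page):

> "Let (5.15) `f(x, y, z) = x^h(1−x)^l y^k(1−y)^s z^j(1−z)^q / (1 − (1−xy)z)^{q+h−r}`. Clearly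
> (5.16) `lim_{n→∞} (1/n) log I_n = max_{0<x,y,z<1} log f(x, y, z)`."

Here `I_n = I(hn, …, sn)` ((5.2), the tree's `I (P.scale n)`), and the integrand of `I_n` is `f^n/(1 − (1−xy)z)`. THIS file
proves (5.16) for every `P` with non-negative parameters satisfying (2.2)–(2.3) (`Nonneg`, `Balanced`), with the
"max" rendered as the supremum `F = sup_{(0,1)³} f` (`supF`; the source takes the maximum, attained at the stationary
point `(x₀, y₀, z₀)` of p. 291 — attainment is neither needed nor proved here): `f = integrand · (1 − (1−xy)z)`
(`fGrowth`), `0 < f ≤ 1` on the open cube (`fGrowth_pos`, `fGrowth_le_one`, from the tree's `integrand_le_one_div`),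
`I_n ≤ F^n I_0` (`I_scale_le`), `I_n ≥ c(η) (F − η)^n` for `0 < η < F` (`I_scale_ge`), `I_n > 0` (`I_scale_pos`), and
**(5.16)** `(1/n) log I_n → log F` (`tendsto_log_I_scale`). Consequently hypothesis (5.18) of `Section5.theorem51` holds
with `c₀ = −log F` (`theorem51_of_514_519`: Theorem 5.1 from (5.14) and (5.19) alone, `c₀ := −log sup f`).

What is NOT here: the location of the maximum ((x₀, y₀, z₀), p. 291) and the value `c₀ = 47.15472079…` (p. 293).

HONEST FRAMING (cells pub-zeta5 / zeta5-irr): an elementary growth statement as printed ("Clearly …"); no measure of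
`ζ(3)` asserted unconditionally; records in print unmoved; nothing about `ζ(5)`.
-/

noncomputable section

namespace Literature.NumberTheory.Irrationality.RhinViola2001

namespace Section5

open Filter Real Topology MeasureTheory Set
open Literature.NumberTheory.Transcendental (zetaValue)
open Literature.NumberTheory.Irrationality.Hata1993 (HasIrrationalityMeasure)
open Theorem21 (integrand_nonneg integrand_le_one_div integrand_eq_pow continuousOn_integrand integrableOn_integrand
  nonneg_scale balanced_scale)
open TheoremTwoOne (den_pos_of_mem measurableSet_cube')

/-! ### (5.15): `f = integrand · (1 − (1−xy)z)` and `integrand(I_n) = fⁿ/(1 − (1−xy)z)` -/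

/-- `D = 1 − (1−xy)z`, the denominator of (2.1)/(5.15). [cite: RhinViola2001, §2 (2.1), §5 (5.15)] -/
def den (p : Fin 3 → ℝ) : ℝ := 1 - (1 - p 0 * p 1) * p 2

/-- On the open cube `0 < D ≤ 1`. [cite: RhinViola2001, §2 (2.1)] -/
theorem den_pos_le_one {p : Fin 3 → ℝ} (hp : p ∈ cube) : 0 < den p ∧ den p ≤ 1 := by
  refine ⟨den_pos_of_mem hp, ?_⟩
  have hx := hp 0; have hy := hp 1; have hz := hp 2
  have h1 : 0 ≤ 1 - p 0 * p 1 := by nlinarith [hx.1, hx.2, hy.1, hy.2]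
  have : 0 ≤ (1 - p 0 * p 1) * p 2 := mul_nonneg h1 hz.1.le
  unfold den; linarith

/-- **(5.15)**: `f(x, y, z) = x^h(1−x)^l y^k(1−y)^s z^j(1−z)^q/(1 − (1−xy)z)^{q+h−r}`, written as the integrand of
(2.1) times `1 − (1−xy)z`. [cite: RhinViola2001, §5 (5.15)] -/
def fGrowth (P : Params) (p : Fin 3 → ℝ) : ℝ := integrand P p * den p

/-- The cube is open. [cite: RhinViola2001, §2 (2.1)] -/
theorem isOpen_cube : IsOpen cube := by
  rw [ThetaInvariance.cube_eq_pi]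
  exact isOpen_set_pi finite_univ fun _ _ => isOpen_Ioo

/-- On the open cube the integrand of (2.1) is positive (non-negative parameters). [cite: RhinViola2001, §2 (2.1)] -/
theorem integrand_pos {P : Params} (hP : P.Nonneg) {p : Fin 3 → ℝ} (hp : p ∈ cube) : 0 < integrand P p := by
  rw [integrand_eq_pow hP]
  have hx := hp 0; have hy := hp 1; have hz := hp 2
  have hD := den_pos_of_mem hp
  have : 0 < 1 - p 0 := by linarith [hx.2]
  have : 0 < 1 - p 1 := by linarith [hy.2]
  have : 0 < 1 - p 2 := by linarith [hz.2]
  have := hx.1; have := hy.1; have := hz.1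
  exact div_pos (by positivity) (zpow_pos hD _)

/-- `0 < f` on the open cube. [cite: RhinViola2001, §5 (5.15)] -/
theorem fGrowth_pos {P : Params} (hP : P.Nonneg) {p : Fin 3 → ℝ} (hp : p ∈ cube) : 0 < fGrowth P p :=
  mul_pos (integrand_pos hP hp) (den_pos_le_one hp).1

/-- `f ≤ 1` on the open cube (from "the integrand is at most `1/(1 − (1−xy)z)`", the tree's `integrand_le_one_div`).
[cite: RhinViola2001, §2 p. 271, §5 (5.15)] -/
theorem fGrowth_le_one {P : Params} (hP : P.Nonneg) (hB : P.Balanced) {p : Fin 3 → ℝ} (hp : p ∈ cube) :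
    fGrowth P p ≤ 1 := by
  have h := integrand_le_one_div hP hB hp
  have hD := den_pos_le_one hp
  unfold fGrowth
  calc integrand P p * den p ≤ 1 / den p * den p := by unfold den at *; gcongr; exact hD.1.le
    _ = 1 := one_div_mul_cancel hD.1.ne'

/-- `f` is continuous on the open cube. [cite: RhinViola2001, §5 (5.15)] -/
theorem continuousOn_fGrowth (P : Params) : ContinuousOn (fGrowth P) cube := by
  have c0 : Continuous fun p : Fin 3 → ℝ => p 0 := continuous_apply 0
  have c1 : Continuous fun p : Fin 3 → ℝ => p 1 := continuous_apply 1
  have c2 : Continuous fun p : Fin 3 → ℝ => p 2 := continuous_apply 2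
  have hden : Continuous den := by
    unfold den; exact continuous_const.sub ((continuous_const.sub (c0.mul c1)).mul c2)
  exact (continuousOn_integrand P).mul hden.continuousOn

/-- **The integrand of `I_n` is `fⁿ/(1 − (1−xy)z)`** on the open cube. [cite: RhinViola2001, §5 (5.2), (5.15), p. 291] -/
theorem integrand_scale (P : Params) (n : ℕ) {p : Fin 3 → ℝ} (hp : p ∈ cube) :
    integrand (P.scale n) p = fGrowth P p ^ n / den p := by
  have hD : den p ≠ 0 := (den_pos_le_one hp).1.ne'
  have key : ∀ (b : ℝ) (a : ℤ), b ^ ((n : ℤ) * a) = (b ^ a) ^ n := fun b a => by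
    rw [mul_comm, zpow_mul, zpow_natCast]
  have hexp : (n : ℤ) * P.q + (n : ℤ) * P.h - (n : ℤ) * P.r + 1 = (n : ℤ) * (P.q + P.h - P.r + 1) + (1 - n) := by
    ring
  simp only [fGrowth, integrand, Params.scale, key]
  rw [hexp, zpow_add₀ (by exact hD), key, zpow_sub₀ (by exact hD), zpow_one, zpow_natCast]
  have hE : (1 - (1 - p 0 * p 1) * p 2) ^ (P.q + P.h - P.r + 1) ≠ 0 := zpow_ne_zero _ hD
  unfold den at hD ⊢
  generalize (1 - (1 - p 0 * p 1) * p 2) ^ (P.q + P.h - P.r + 1) = E at hE ⊢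
  generalize p 0 ^ P.h = A₁
  generalize (1 - p 0) ^ P.l = A₂
  generalize p 1 ^ P.k = A₃
  generalize (1 - p 1) ^ P.s = A₄
  generalize p 2 ^ P.j = A₅
  generalize (1 - p 2) ^ P.q = A₆
  generalize 1 - (1 - p 0 * p 1) * p 2 = D at hD ⊢
  simp only [div_eq_mul_inv, mul_inv, inv_inv, ← inv_pow]
  ring

/-! ### `F = sup f`, the upper bound `I_n ≤ Fⁿ I_0` and the lower bound `I_n ≥ c(η)(F − η)ⁿ` -/

/-- **`F = sup_{(0,1)³} f`** (the "max" of (5.16)). [cite: RhinViola2001, §5 (5.16)] -/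
def supF (P : Params) : ℝ := sSup (fGrowth P '' cube)

/-- The centre of the cube lies in it (non-emptiness). [cite: RhinViola2001, §2 (2.1)] -/
theorem half_mem_cube : (fun _ : Fin 3 => (1 / 2 : ℝ)) ∈ cube := fun _ => by norm_num [Set.mem_Ioo]

/-- `f '' cube` is bounded above by `1`. [cite: RhinViola2001, §5 (5.15)] -/
theorem bddAbove_fGrowth {P : Params} (hP : P.Nonneg) (hB : P.Balanced) : BddAbove (fGrowth P '' cube) :=
  ⟨1, by rintro _ ⟨p, hp, rfl⟩; exact fGrowth_le_one hP hB hp⟩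

/-- `f ≤ F` on the cube. [cite: RhinViola2001, §5 (5.16)] -/
theorem fGrowth_le_supF {P : Params} (hP : P.Nonneg) (hB : P.Balanced) {p : Fin 3 → ℝ} (hp : p ∈ cube) :
    fGrowth P p ≤ supF P :=
  le_csSup (bddAbove_fGrowth hP hB) ⟨p, hp, rfl⟩

/-- `0 < F ≤ 1`. [cite: RhinViola2001, §5 (5.16)] -/
theorem supF_pos_le_one {P : Params} (hP : P.Nonneg) (hB : P.Balanced) : 0 < supF P ∧ supF P ≤ 1 :=
  ⟨lt_of_lt_of_le (fGrowth_pos hP half_mem_cube) (fGrowth_le_supF hP hB half_mem_cube),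
    csSup_le ⟨_, ⟨_, half_mem_cube, rfl⟩⟩ (by rintro _ ⟨p, hp, rfl⟩; exact fGrowth_le_one hP hB hp)⟩

/-- **Upper bound `I_n ≤ Fⁿ · I_0`** (`I_0 = ∫ dx dy dz/(1 − (1−xy)z) = 2ζ(3)`). [cite: RhinViola2001, §5 (5.16)] -/
theorem I_scale_le {P : Params} (hP : P.Nonneg) (hB : P.Balanced) (n : ℕ) :
    I (P.scale n) ≤ supF P ^ n * I (P.scale 0) := by
  have hN : ∀ m : ℕ, (P.scale m).Nonneg := fun m => nonneg_scale hP (by positivity)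
  have hBm : ∀ m : ℕ, (P.scale m).Balanced := fun m => balanced_scale hB m
  have hint0 : IntegrableOn (integrand (P.scale 0)) cube := by
    simpa using integrableOn_integrand (hN 0) (hBm 0)
  unfold I
  rw [← integral_const_mul]
  refine setIntegral_mono_on (integrableOn_integrand (hN n) (hBm n))
    (hint0.const_mul _) measurableSet_cube' fun p hp => ?_
  have h0 : integrand (P.scale 0) p = 1 / den p := by
    simpa using integrand_scale P 0 hp
  rw [integrand_scale P n hp, h0]
  have hD := (den_pos_le_one hp).1
  rw [div_le_iff₀ hD, mul_assoc, div_mul_cancel₀ _ hD.ne', mul_one]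
  exact pow_le_pow_left₀ (fGrowth_pos hP hp).le (fGrowth_le_supF hP hB hp) n

/-- **Lower bound**: for `0 < η < F` there is `c > 0` (the volume of a small ball on which `f > F − η`) with
`I_n ≥ c (F − η)ⁿ` for all `n`. [cite: RhinViola2001, §5 (5.16)] -/
theorem I_scale_ge {P : Params} (hP : P.Nonneg) (hB : P.Balanced) {η : ℝ} (hη : 0 < η) (hηF : η < supF P) :
    ∃ c : ℝ, 0 < c ∧ ∀ n : ℕ, c * (supF P - η) ^ n ≤ I (P.scale n) := by
  have hN : ∀ m : ℕ, (P.scale m).Nonneg := fun m => nonneg_scale hP (by positivity)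
  have hBm : ∀ m : ℕ, (P.scale m).Balanced := fun m => balanced_scale hB m
  -- a point `p₀` of the cube with `f p₀ > F − η`, and a ball around it inside the cube on which `f > F − η`
  obtain ⟨_, ⟨p₀, hp₀, rfl⟩, hgt⟩ :=
    exists_lt_of_lt_csSup (⟨_, ⟨_, half_mem_cube, rfl⟩⟩ : (fGrowth P '' cube).Nonempty) (by linarith : supF P - η < supF P)
  have hcont : ContinuousAt (fGrowth P) p₀ :=
    (continuousOn_fGrowth P).continuousAt (isOpen_cube.mem_nhds hp₀)
  have hev : ∀ᶠ p in 𝓝 p₀, supF P - η < fGrowth P p ∧ p ∈ cube :=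
    (hcont.eventually (lt_mem_nhds hgt)).and (isOpen_cube.mem_nhds hp₀)
  obtain ⟨δ, hδ, hball⟩ := Metric.mem_nhds_iff.1 hev
  set B : Set (Fin 3 → ℝ) := Metric.ball p₀ δ with hB_def
  have hBcube : B ⊆ cube := fun p hp => (hball hp).2
  have hBvol_lt : volume B < ⊤ := measure_ball_lt_top
  have hBvol_pos : 0 < (volume B).toReal :=
    ENNReal.toReal_pos (Metric.measure_ball_pos volume p₀ hδ).ne' hBvol_lt.ne
  refine ⟨(volume B).toReal, hBvol_pos, fun n => ?_⟩
  have hFη : 0 < supF P - η := by linarith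
  -- `c (F−η)ⁿ = ∫_B (F−η)ⁿ ≤ ∫_B integrand(I_n) ≤ ∫_cube integrand(I_n) = I_n`
  have h1 : (volume B).toReal * (supF P - η) ^ n = ∫ _ in B, (supF P - η) ^ n := by
    rw [setIntegral_const, smul_eq_mul, Measure.real]
  have hint : IntegrableOn (integrand (P.scale n)) B volume :=
    (integrableOn_integrand (hN n) (hBm n)).mono_set hBcube
  have h2 : ∫ _ in B, (supF P - η) ^ n ≤ ∫ p in B, integrand (P.scale n) p := by
    refine setIntegral_mono_on (integrableOn_const (hs := hBvol_lt.ne)) hint measurableSet_ball fun p hpB => ?_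
    have hp := hBcube hpB
    have hD := den_pos_le_one hp
    rw [integrand_scale P n hp, le_div_iff₀ hD.1]
    calc (supF P - η) ^ n * den p ≤ (supF P - η) ^ n * 1 := by gcongr; exact hD.2
      _ = (supF P - η) ^ n := mul_one _
      _ ≤ fGrowth P p ^ n := pow_le_pow_left₀ hFη.le (hball hpB).1.le n
  have h3 : ∫ p in B, integrand (P.scale n) p ≤ ∫ p in cube, integrand (P.scale n) p :=
    setIntegral_mono_set (integrableOn_integrand (hN n) (hBm n))
      (ae_restrict_of_forall_mem measurableSet_cube' fun p hp => integrand_nonneg (hN n) hp)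
      hBcube.eventuallyLE
  unfold I
  linarith

/-- `I_n > 0`. [cite: RhinViola2001, §2 p. 271 ("this integral is finite …"), §5 (5.16)] -/
theorem I_scale_pos {P : Params} (hP : P.Nonneg) (hB : P.Balanced) (n : ℕ) : 0 < I (P.scale n) := by
  have hF := (supF_pos_le_one hP hB).1
  obtain ⟨c, hc, h⟩ := I_scale_ge hP hB (by positivity : 0 < supF P / 2) (by linarith)
  have h2 : 0 < supF P - supF P / 2 := by linarith
  exact lt_of_lt_of_le (mul_pos hc (pow_pos h2 n)) (h n)

/-- **(5.16)**: `lim_{n→∞} (1/n) log I_n = log F`, `F = sup_{(0,1)³} f` ("`= max log f`").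
[cite: RhinViola2001, §5 (5.16)] -/
theorem tendsto_log_I_scale {P : Params} (hP : P.Nonneg) (hB : P.Balanced) :
    Tendsto (fun n : ℕ => Real.log (I (P.scale n)) / n) atTop (𝓝 (Real.log (supF P))) := by
  have hF := (supF_pos_le_one hP hB).1
  have hI0 : 0 < I (P.scale 0) := by simpa using I_scale_pos hP hB 0
  rw [Metric.tendsto_atTop]
  intro ε hε
  -- `η` with `log(F − η) = log F − ε/2`
  set η : ℝ := supF P * (1 - Real.exp (-(ε / 2))) with hη_def
  have hexp1 : Real.exp (-(ε / 2)) < 1 := Real.exp_lt_one_iff.2 (by linarith)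
  have hη : 0 < η := by rw [hη_def]; exact mul_pos hF (by linarith)
  have hηF : η < supF P := by
    rw [hη_def]; nlinarith [Real.exp_pos (-(ε / 2))]
  have hlogη : Real.log (supF P - η) = Real.log (supF P) - ε / 2 := by
    have : supF P - η = supF P * Real.exp (-(ε / 2)) := by rw [hη_def]; ring
    rw [this, Real.log_mul hF.ne' (Real.exp_pos _).ne', Real.log_exp]; ring
  obtain ⟨c, hc, hlow⟩ := I_scale_ge hP hB hη hηF
  -- `N` beyond which the two error terms `log c / n`, `log I_0 / n` are `< ε/2` in size
  obtain ⟨N, hN⟩ := exists_nat_gt (2 * (|Real.log c| + |Real.log (I (P.scale 0))|) / ε)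
  refine ⟨N + 1, fun n hn => ?_⟩
  have hn0 : (0 : ℝ) < n := by exact_mod_cast (by omega : 0 < n)
  have hnN : (N : ℝ) + 1 ≤ n := by exact_mod_cast hn
  have hIn := I_scale_pos hP hB n
  -- upper: `log I_n ≤ n log F + log I_0`
  have hup : Real.log (I (P.scale n)) ≤ n * Real.log (supF P) + Real.log (I (P.scale 0)) := by
    have h := Real.log_le_log hIn (I_scale_le hP hB n)
    rwa [Real.log_mul (pow_pos hF n).ne' hI0.ne', Real.log_pow] at h
  -- lower: `log I_n ≥ log c + n (log F − ε/2)`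
  have hFη : 0 < supF P - η := by linarith
  have hlo : Real.log c + n * (Real.log (supF P) - ε / 2) ≤ Real.log (I (P.scale n)) := by
    have h := Real.log_le_log (mul_pos hc (pow_pos hFη n)) (hlow n)
    rwa [Real.log_mul hc.ne' (pow_pos hFη n).ne', Real.log_pow, hlogη] at h
  -- the two error terms
  have hsmall : |Real.log c| + |Real.log (I (P.scale 0))| < ε / 2 * n := by
    have h1 : 2 * (|Real.log c| + |Real.log (I (P.scale 0))|) / ε < n := by linarith
    rw [div_lt_iff₀ hε] at h1
    linarith
  rw [Real.dist_eq, abs_sub_lt_iff]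
  constructor
  · -- `log I_n / n − log F < ε`
    rw [sub_lt_iff_lt_add, div_lt_iff₀ hn0]
    have : Real.log (I (P.scale 0)) ≤ |Real.log (I (P.scale 0))| := le_abs_self _
    nlinarith [abs_nonneg (Real.log c)]
  · -- `log F − log I_n / n < ε`
    rw [sub_lt_comm, lt_div_iff₀ hn0]
    have : -|Real.log c| ≤ Real.log c := neg_abs_le _
    nlinarith [abs_nonneg (Real.log (I (P.scale 0)))]

/-- **(5.18) for the record parameters with `c₀ = −log sup f`**, hence **Theorem 5.1 from (5.14) and (5.19) alone**:
for any `I_n = a_n + 2b_nζ(3)`, (5.14) `lim (1/n) log D_n = c₂`, (5.19) `limsup (1/n) log|b_n| ≤ c₁` (unfolded form),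
`c₁ + c₂ > 0` and `c₀ := −log F > c₂` give `μ(ζ(3)) ≤ (c₀ + c₁)/(c₀ − c₂)`.
[cite: RhinViola2001, Theorem 5.1 (p. 292) with (5.16), (5.18)] -/
theorem theorem51_of_514_519 {c₁ c₂ : ℝ} (a : ℕ → ℚ) (b : ℕ → ℤ)
    (hab : ∀ n : ℕ, 1 ≤ n → I (rvChoice.scale n) = a n + 2 * b n * zetaValue 3)
    (h514 : Tendsto (fun n : ℕ => Real.log (bigD n) / n) atTop (𝓝 c₂))
    (h519 : ∀ δ : ℝ, 0 < δ → ∀ᶠ n : ℕ in atTop, Real.log |(b n : ℝ)| / n ≤ c₁ + δ)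
    (hS : 0 < c₁ + c₂) (hc : c₂ < -Real.log (supF rvChoice)) :
    HasIrrationalityMeasure (zetaValue 3)
      ((-Real.log (supF rvChoice) + c₁) / (-Real.log (supF rvChoice) - c₂)) := by
  have h518 : Tendsto (fun n : ℕ => Real.log (I (rvChoice.scale n)) / n) atTop
      (𝓝 (-(-Real.log (supF rvChoice)))) := by
    rw [neg_neg]; exact tendsto_log_I_scale rvChoice_admissible.2.1 rvChoice_admissible.1
  exact theorem51 a b hab h514 h518 h519 hS hc

end Section5

end Literature.NumberTheory.Irrationality.RhinViola2001

end
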